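import Summits.PneNP.PneNP.Theorems.CliqueExtLowerBound.Negative.LargeCliquesCircuit
import Summits.PneNP.PneNP.Theorems.CliqueExtLowerBound.Negative.LoadBearing
import Mathlib.Data.Fintype.Perm
import Mathlib.Data.Fintype.BigOperators
import Mathlib.Analysis.Complex.ExponentialBounds
import Mathlib.Data.Nat.Choose.Bounds
import Mathlib.Data.Nat.Log

/-!
# `CliqueExtLowerBound` (stmt-PneNP-10682) — negative-side lemmas: very large cliques III (hash families; the refuted regime)

Continuation of `LargeCliquesTwoSat.lean` / `LargeCliquesCircuit.lean`. This file: §5 perfect hash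
families by counting (`exists_perfect_hash_family`: if `C(m,k)·(1 - k!/k^k)^L < 1` then `L` functions
`Fin m → Fin k` are between them injective on every `k`-set; Mehlhorn–Schmidt 1982); §6 numerics for the
schedule `k = c·⌊log₃ m⌋`, `L = m^(c+2)` (`hash_condition`), the circuit `exists_circuit_largeClique`
(size `≤ m^(c+7)` over `extGate (m^(c+7))`, eventually in `m`), and the REFUTED REGIME
`not_lowerBoundAt_sub_clog : ¬ LowerBoundAt (fun m => m - c * Nat.log 3 m)` for every `c ≥ 1` — a
schedule with `C(m, k) = m^Θ(log m)` superpolynomial, so outside the single-gate kills of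
`LoadBearing.lean` §1. Refuter seat cdisprove-stmt-PneNP-10682-g2, 2026-08-16.
-/

namespace Summit.PneNP.PneNP.Theorems.CliqueExtLowerBound.Negative

open Literature.Computability.Complexity Literature.Computability.Complexity.CliqueLPGate Finset

/-! ### 5. Perfect hash families by counting (Mehlhorn–Schmidt) -/

section Hashing

variable {m k : ℕ}

/-- Functions injective on `S` are at least `k! · k^{m-k}` in number (`#S = k`): glue a bijection
`S ≃ Fin k` with an arbitrary function on the complement. [folklore] -/
theorem card_injOn_ge (S : Finset (Fin m)) (hS : S.card = k) :
    k.factorial * k ^ (m - k) ≤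
      (Finset.univ.filter fun f : Fin m → Fin k => Set.InjOn f ↑S).card := by
  classical
  have hcardS : Fintype.card ↥S = k := by rw [Fintype.card_coe, hS]
  have hcardC : Fintype.card ↥(Sᶜ) = m - k := by rw [Fintype.card_coe, Finset.card_compl, Fintype.card_fin, hS]
  let e : ↥S ≃ Fin k := Fintype.equivFinOfCardEq hcardS
  let φ : (↥S ≃ Fin k) × (↥(Sᶜ) → Fin k) → (Fin m → Fin k) := fun gr u =>
    if hu : u ∈ S then gr.1 ⟨u, hu⟩ else gr.2 ⟨u, Finset.mem_compl.2 hu⟩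
  have hinj : Function.Injective φ := by
    rintro ⟨g, r⟩ ⟨g', r'⟩ hφ
    have h1 : g = g' := by
      refine Equiv.ext fun u => ?_
      have := congrFun hφ u.1
      simpa [φ, u.2] using this
    have h2 : r = r' := by
      funext u
      have hu : u.1 ∉ S := Finset.mem_compl.1 u.2
      have := congrFun hφ u.1
      simpa [φ, hu] using this
    rw [h1, h2]
  have hmaps : ∀ gr ∈ (Finset.univ : Finset ((↥S ≃ Fin k) × (↥(Sᶜ) → Fin k))),
      φ gr ∈ (Finset.univ.filter fun f : Fin m → Fin k => Set.InjOn f ↑S) := by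
    rintro ⟨g, r⟩ -
    simp only [Finset.mem_filter, Finset.mem_univ, true_and]
    intro a ha b hb hab
    simp only [Finset.mem_coe] at ha hb
    simp only [φ, ha, hb, dif_pos] at hab
    exact congrArg Subtype.val (g.injective hab)
  calc k.factorial * k ^ (m - k)
      = Fintype.card ((↥S ≃ Fin k) × (↥(Sᶜ) → Fin k)) := by
        rw [Fintype.card_prod, Fintype.card_equiv e, Fintype.card_fun, hcardS, hcardC, Fintype.card_fin]
    _ = (Finset.univ : Finset ((↥S ≃ Fin k) × (↥(Sᶜ) → Fin k))).card := Finset.card_univ.symm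
    _ ≤ _ := Finset.card_le_card_of_injOn φ hmaps (hinj.injOn)

/-- Hence at most `k^m - k!·k^{m-k}` functions fail to be injective on `S`. [folklore] -/
theorem card_not_injOn_le (S : Finset (Fin m)) (hS : S.card = k) :
    (Finset.univ.filter fun f : Fin m → Fin k => ¬ Set.InjOn f ↑S).card ≤ k ^ m - k.factorial * k ^ (m - k) := by
  classical
  have h := Finset.card_filter_add_card_filter_not (s := (Finset.univ : Finset (Fin m → Fin k)))
    (p := fun f : Fin m → Fin k => Set.InjOn f ↑S)
  rw [Finset.card_univ, Fintype.card_fun, Fintype.card_fin, Fintype.card_fin] at h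
  have := card_injOn_ge S hS
  omega

/-- **Perfect hash families exist** (Mehlhorn–Schmidt counting): if `C(m,k) · (1 - k!/k^k)^L < 1` then some
`L` functions `Fin m → Fin k` are, between them, injective on every `k`-set. [folklore] -/
theorem exists_perfect_hash_family (hk : 1 ≤ k) (hkm : k ≤ m) {L : ℕ}
    (hL : (m.choose k : ℝ) * (1 - (k.factorial : ℝ) / (k : ℝ) ^ k) ^ L < 1) :
    ∃ 𝓗 : Finset (Fin m → Fin k), 𝓗.card ≤ L ∧
      ∀ S : Finset (Fin m), S.card = k → ∃ h ∈ 𝓗, Set.InjOn h ↑S := by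
  classical
  let NonInj : Finset (Fin m) → Finset (Fin m → Fin k) := fun S =>
    Finset.univ.filter fun f => ¬ Set.InjOn f ↑S
  let Bad : Finset (Fin m) → Finset (Fin L → (Fin m → Fin k)) := fun S => Fintype.piFinset fun _ => NonInj S
  let BadAll : Finset (Fin L → (Fin m → Fin k)) := (Finset.powersetCard k Finset.univ).biUnion Bad
  -- the count
  set N₀ : ℕ := k ^ m - k.factorial * k ^ (m - k) with hN₀def
  have hfac : k.factorial * k ^ (m - k) ≤ k ^ m := by
    calc k.factorial * k ^ (m - k) ≤ k ^ k * k ^ (m - k) :=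
          Nat.mul_le_mul_right _ (Nat.factorial_le_pow k)
      _ = k ^ m := by rw [← pow_add, Nat.add_sub_cancel' hkm]
  have hcardBad : ∀ S : Finset (Fin m), S.card = k → (Bad S).card ≤ N₀ ^ L := by
    intro S hS
    simp only [Bad, Fintype.card_piFinset, Finset.prod_const, Finset.card_univ, Fintype.card_fin]
    exact Nat.pow_le_pow_left (card_not_injOn_le S hS) L
  have hBadAll : BadAll.card ≤ m.choose k * N₀ ^ L := by
    calc BadAll.card ≤ ∑ S ∈ Finset.powersetCard k Finset.univ, (Bad S).card := Finset.card_biUnion_le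
      _ ≤ ∑ S ∈ Finset.powersetCard k (Finset.univ : Finset (Fin m)), N₀ ^ L :=
          Finset.sum_le_sum fun S hS => hcardBad S (Finset.mem_powersetCard.1 hS).2
      _ = m.choose k * N₀ ^ L := by
          rw [Finset.sum_const, Finset.card_powersetCard, Finset.card_univ, Fintype.card_fin, smul_eq_mul]
  have hk0 : (0 : ℝ) < (k : ℝ) := by exact_mod_cast hk
  have hreal : (m.choose k : ℝ) * (N₀ : ℝ) ^ L < ((k : ℝ) ^ m) ^ L := by
    have hN₀ : (N₀ : ℝ) = (k : ℝ) ^ m * (1 - (k.factorial : ℝ) / (k : ℝ) ^ k) := by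
      rw [hN₀def, Nat.cast_sub hfac]
      push_cast
      have hkm' : (k : ℝ) ^ m = (k : ℝ) ^ k * (k : ℝ) ^ (m - k) := by
        rw [← pow_add, Nat.add_sub_cancel' hkm]
      rw [hkm']
      have hkk : (k : ℝ) ^ k ≠ 0 := pow_ne_zero _ hk0.ne'
      field_simp
    have hpos : (0 : ℝ) < ((k : ℝ) ^ m) ^ L := pow_pos (pow_pos hk0 m) L
    rw [hN₀, mul_pow]
    calc (m.choose k : ℝ) * ((((k : ℝ) ^ m) ^ L) * (1 - (k.factorial : ℝ) / (k : ℝ) ^ k) ^ L)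
        = ((k : ℝ) ^ m) ^ L * ((m.choose k : ℝ) * (1 - (k.factorial : ℝ) / (k : ℝ) ^ k) ^ L) := by ring
      _ < ((k : ℝ) ^ m) ^ L * 1 := mul_lt_mul_of_pos_left hL hpos
      _ = ((k : ℝ) ^ m) ^ L := mul_one _
  have hnat : m.choose k * N₀ ^ L < (k ^ m) ^ L := by exact_mod_cast hreal
  have hcount : BadAll.card < (Finset.univ : Finset (Fin L → (Fin m → Fin k))).card := by
    rw [Finset.card_univ, Fintype.card_fun, Fintype.card_fun, Fintype.card_fin, Fintype.card_fin,
      Fintype.card_fin]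
    exact hBadAll.trans_lt hnat
  obtain ⟨t, -, ht⟩ := Finset.exists_mem_notMem_of_card_lt_card hcount
  refine ⟨Finset.univ.image t, Finset.card_image_le.trans (by simp), fun S hS => ?_⟩
  have htS : t ∉ Bad S := fun hb =>
    ht (Finset.mem_biUnion.2 ⟨S, Finset.mem_powersetCard.2 ⟨Finset.subset_univ _, hS⟩, hb⟩)
  simp only [Bad, NonInj, Fintype.mem_piFinset, Finset.mem_filter, Finset.mem_univ, true_and, not_forall,
    not_not] at htS
  obtain ⟨i, hi⟩ := htS
  exact ⟨t i, Finset.mem_image.2 ⟨i, Finset.mem_univ _, rfl⟩, hi⟩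

end Hashing


/-! ### 6. Assembly: CLIQUE(m, m - c·log₃ m) has polynomial-size extended (indeed {∧,∨}) circuits -/

section Assembly

open Filter Real

/-- `t² ≤ 3^t`. [folklore] -/
theorem sq_le_three_pow (t : ℕ) : t ^ 2 ≤ 3 ^ t := by
  induction t with
  | zero => simp
  | succ t ih =>
    have h1 : t < 3 ^ t := Nat.lt_pow_self (by norm_num)
    calc (t + 1) ^ 2 = t ^ 2 + 2 * t + 1 := by ring
      _ ≤ 3 ^ t + 2 * 3 ^ t := by omega
      _ = 3 ^ (t + 1) := by ring

/-- The schedule `k = c · log₃ m` satisfies `1 ≤ k ≤ m` once `m ≥ 3^c`, `c ≥ 1`. [folklore] -/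
theorem clog_bounds {c m : ℕ} (hc : 1 ≤ c) (hm : 3 ^ c ≤ m) :
    1 ≤ c * Nat.log 3 m ∧ c * Nat.log 3 m ≤ m := by
  have hm0 : m ≠ 0 := by have := Nat.one_le_pow c 3 (by norm_num); omega
  have ht : c ≤ Nat.log 3 m := Nat.le_log_of_pow_le (by norm_num) hm
  have hc1 : 1 ≤ Nat.log 3 m := hc.trans ht
  refine ⟨Nat.one_le_iff_ne_zero.2 (Nat.mul_ne_zero (by omega) (by omega)), ?_⟩
  calc c * Nat.log 3 m ≤ Nat.log 3 m * Nat.log 3 m := Nat.mul_le_mul_right _ ht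
    _ = Nat.log 3 m ^ 2 := (sq _).symm
    _ ≤ 3 ^ Nat.log 3 m := sq_le_three_pow _
    _ ≤ m := Nat.pow_log_le_self 3 hm0

/-- The Mehlhorn–Schmidt condition for `k = c·log₃ m` and `L = m^{c+2}` (`m ≥ 3^c`, `m ≥ 2`):
`C(m,k) · (1 - k!/k^k)^L ≤ e^m · e^{-m²} < 1` (using `k!/k^k ≥ e^{-k} ≥ 3^{-k} ≥ m^{-c}`). [folklore] -/
theorem hash_condition {c m : ℕ} (hc : 1 ≤ c) (hm : 3 ^ c ≤ m) (hm2 : 2 ≤ m) :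
    (m.choose (c * Nat.log 3 m) : ℝ) *
      (1 - ((c * Nat.log 3 m).factorial : ℝ) / ((c * Nat.log 3 m : ℕ) : ℝ) ^ (c * Nat.log 3 m)) ^ (m ^ (c + 2)) < 1 := by
  obtain ⟨hk1, hkm⟩ := clog_bounds hc hm
  set k := c * Nat.log 3 m with hkdef
  have hm0 : m ≠ 0 := by omega
  have hk0 : (0 : ℝ) < (k : ℝ) := by exact_mod_cast hk1
  have hkk : (0 : ℝ) < (k : ℝ) ^ k := pow_pos hk0 k
  set p : ℝ := (k.factorial : ℝ) / (k : ℝ) ^ k with hpdef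
  -- p ≥ e^{-k} ≥ m^{-c}
  have hp_ge : ((m : ℝ) ^ c)⁻¹ ≤ p := by
    have h1 : (k : ℝ) ^ k / (k.factorial : ℝ) ≤ Real.exp k := Real.pow_div_factorial_le_exp (k : ℝ) hk0.le k
    have hfpos : (0 : ℝ) < (k.factorial : ℝ) := by exact_mod_cast Nat.factorial_pos k
    have h2 : (Real.exp k)⁻¹ ≤ p := by
      rw [div_le_iff₀ hfpos] at h1
      rw [hpdef, inv_eq_one_div, div_le_div_iff₀ (Real.exp_pos _) hkk]
      nlinarith [h1]
    have h3 : Real.exp k ≤ (m : ℝ) ^ c := by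
      calc Real.exp k = Real.exp 1 ^ k := by rw [← Real.exp_nat_mul, mul_one]
        _ ≤ (3 : ℝ) ^ k := pow_le_pow_left₀ (Real.exp_pos _).le Real.exp_one_lt_three.le k
        _ = ((3 ^ Nat.log 3 m : ℕ) : ℝ) ^ c := by rw [hkdef, mul_comm, pow_mul]; push_cast; ring
        _ ≤ (m : ℝ) ^ c := by
            gcongr
            exact_mod_cast Nat.pow_log_le_self 3 hm0
    calc ((m : ℝ) ^ c)⁻¹ ≤ (Real.exp k)⁻¹ := by
          rw [inv_le_inv₀ (pow_pos (by exact_mod_cast Nat.pos_of_ne_zero hm0) c) (Real.exp_pos _)]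
          exact h3
      _ ≤ p := h2
  have hp_le : p ≤ 1 := by
    rw [hpdef, div_le_one hkk]
    exact_mod_cast Nat.factorial_le_pow k
  -- (1 - p)^L ≤ exp (-p L) ≤ exp (-m²)
  have hL : (1 - p) ^ (m ^ (c + 2)) ≤ Real.exp (-(m : ℝ) ^ 2) := by
    calc (1 - p) ^ (m ^ (c + 2)) ≤ (Real.exp (-p)) ^ (m ^ (c + 2)) :=
          pow_le_pow_left₀ (by linarith) (Real.one_sub_le_exp_neg p) _
      _ = Real.exp (-(p * (m : ℝ) ^ (c + 2))) := by
          rw [← Real.exp_nat_mul]; congr 1; push_cast; ring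
      _ ≤ Real.exp (-(m : ℝ) ^ 2) := by
          rw [Real.exp_le_exp, neg_le_neg_iff]
          have hmpos : (0 : ℝ) < (m : ℝ) ^ c := pow_pos (by exact_mod_cast Nat.pos_of_ne_zero hm0) c
          calc (m : ℝ) ^ 2 = ((m : ℝ) ^ c)⁻¹ * (m : ℝ) ^ (c + 2) := by
                rw [pow_add, ← mul_assoc, inv_mul_cancel₀ hmpos.ne', one_mul]
            _ ≤ p * (m : ℝ) ^ (c + 2) := mul_le_mul_of_nonneg_right hp_ge (by positivity)
  -- C(m,k) ≤ 2^m ≤ e^m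
  have hchoose : (m.choose k : ℝ) ≤ Real.exp m := by
    calc (m.choose k : ℝ) ≤ ((2 ^ m : ℕ) : ℝ) := by exact_mod_cast Nat.choose_le_two_pow m k
      _ = (2 : ℝ) ^ m := by push_cast; ring
      _ ≤ Real.exp 1 ^ m := pow_le_pow_left₀ (by norm_num)
          (by have := Real.add_one_le_exp 1; norm_num at this ⊢; linarith) m
      _ = Real.exp m := by rw [← Real.exp_nat_mul, mul_one]
  have hpos1 : (0 : ℝ) ≤ (1 - p) ^ (m ^ (c + 2)) := pow_nonneg (by linarith) _
  calc (m.choose k : ℝ) * (1 - p) ^ (m ^ (c + 2)) ≤ Real.exp m * Real.exp (-(m : ℝ) ^ 2) :=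
        mul_le_mul hchoose hL hpos1 (Real.exp_pos _).le
    _ = Real.exp ((m : ℝ) - (m : ℝ) ^ 2) := by rw [← Real.exp_add]; ring_nf
    _ < 1 := by
        have hm2' : (2 : ℝ) ≤ m := by exact_mod_cast hm2
        calc Real.exp ((m : ℝ) - (m : ℝ) ^ 2) < Real.exp 0 := Real.exp_lt_exp.2 (by nlinarith)
          _ = 1 := Real.exp_zero

/-- The per-colouring size is `O(m⁴)`: `cutCircuitSize m ≤ 38 m⁴` for `m ≥ 1`. [folklore] -/
theorem cutCircuitSize_le {m : ℕ} (hm : 1 ≤ m) : cutCircuitSize m ≤ 38 * m ^ 4 := by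
  simp only [cutCircuitSize, Fintype.card_prod, Fintype.card_bool, Fintype.card_option, Fintype.card_fin,
    mul_one]
  have h2 : m ≤ m ^ 2 := by nlinarith
  have h3 : m ^ 2 ≤ m ^ 3 := by nlinarith
  have h4 : m ^ 3 ≤ m ^ 4 := by nlinarith
  nlinarith

/-- **Small circuits for very large cliques**: for every `c ≥ 1`, eventually in `m`, some circuit over the
extended monotone basis `B_{m^{c+7}}` — in fact over `{∧, ∨}` with unbounded fan-in — with at most
`m^{c+7}` gates computes `CLIQUE(m, m - c·⌊log₃ m⌋)`. [folklore] -/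
theorem exists_circuit_largeClique (c : ℕ) (hc : 1 ≤ c) :
    ∀ᶠ m : ℕ in atTop, ∃ C : Circuit (Ed m), C.IsOver (extGate (m ^ (c + 7))) ∧
      C.size ≤ m ^ (c + 7) ∧ C.Computes (cliqueFn m (m - c * Nat.log 3 m)) := by
  filter_upwards [eventually_ge_atTop (3 ^ c), eventually_ge_atTop 39] with m hm hm39
  classical
  obtain ⟨hk1, hkm⟩ := clog_bounds hc hm
  set k := c * Nat.log 3 m with hkdef
  obtain ⟨𝓗, hcard, hperf⟩ := exists_perfect_hash_family hk1 hkm (L := m ^ (c + 2))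
    (hash_condition hc hm (by omega))
  have hB : GoodBasis (extGate (m ^ (c + 7))) := GoodBasis.extGate (Nat.one_le_pow _ _ (by omega))
  obtain ⟨C, hC, hs, he⟩ := (cktSize_family (B := extGate (m ^ (c + 7))) hB 𝓗).toCircuit
  refine ⟨C, hC, hs.trans ?_, fun x => ?_⟩
  · -- size bookkeeping
    have h1 : Fintype.card ↥𝓗 ≤ m ^ (c + 2) := by rw [Fintype.card_coe]; exact hcard
    have h2 := cutCircuitSize_le (m := m) (by omega)
    have h3 : m ^ (c + 2) * (38 * m ^ 4) + 1 ≤ m ^ (c + 7) := by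
      have : 39 * m ^ (c + 6) ≤ m ^ (c + 7) := by
        calc 39 * m ^ (c + 6) ≤ m * m ^ (c + 6) := Nat.mul_le_mul_right _ hm39
          _ = m ^ (c + 7) := by ring
      have : 1 ≤ m ^ (c + 6) := Nat.one_le_pow _ _ (by omega)
      have : m ^ (c + 2) * (38 * m ^ 4) = 38 * m ^ (c + 6) := by ring
      omega
    calc Fintype.card ↥𝓗 * cutCircuitSize m + 1 ≤ m ^ (c + 2) * (38 * m ^ 4) + 1 := by
          gcongr
      _ ≤ m ^ (c + 7) := h3
  · -- correctness
    rw [he x, Bool.eq_iff_iff, decide_eq_true_iff,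
      cliqueFn_sub_eq_true_iff_exists_coloring_cut hkm (𝓗 := (↑𝓗 : Set (Fin m → Fin k)))
        (fun S hS => by
          obtain ⟨h, hh, hinj⟩ := hperf S hS
          exact ⟨h, Finset.mem_coe.2 hh, hinj⟩) x]
    simp only [Finset.mem_coe]

/-- **A new refuted regime: `m - k = Θ(log m)`.** For every `c ≥ 1` the lower bound at the schedule
`k(m) = m - c·⌊log₃ m⌋` is FALSE — already for plain {∧,∨}-circuits: colour-coding + 2-SAT cuts give
monotone circuits of size `m^{O(c)}` (this file), improving Andreev–Jukna 2008 (poly only for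
`m - k = O(√log m)`, Jukna 2012 Thm 9.7) on the circuit side; the complementary lower bound side
(Jukna 2012, Prop 9.6) makes CLIQUE(m, m - t) monotone-hard only for `t = ω(log³ m)`. Since
`C(m, c log m) = m^{Θ(log m)}` is superpolynomial, this regime is NOT covered by the LP/PERM single-gate
refutations (`not_lowerBoundAt_of_choose_le`). [folklore] -/
theorem not_lowerBoundAt_sub_clog (c : ℕ) (hc : 1 ≤ c) :
    ¬ LowerBoundAt fun m => m - c * Nat.log 3 m := by
  intro hLB
  obtain ⟨m, hm, C, hC, hs, hcomp⟩ := ((hLB (c + 7)).and (exists_circuit_largeClique c hc)).exists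
  exact hm C hC hs hcomp

end Assembly

end Summit.PneNP.PneNP.Theorems.CliqueExtLowerBound.Negative
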